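import Mathlib.LinearAlgebra.Matrix.NonsingularInverse
import Mathlib.FieldTheory.IsAlgClosed.Basic
import Literature.Computability.AlgebraicComplexity.SmallFormatRankNormalization
import Literature.Computability.AlgebraicComplexity.SmallFormatRankIsotropic
import HarnessLib

/-!
# Bläser's normalisation lemma for short computations of `⟨n,m,n⟩` (Bläser 2003, Lemma 7)

Topic `Literature/Computability/AlgebraicComplexity`. Fifth proof file behind
`SmallFormatRank.lean` (target `blaser2003_thm14`, Bläser 2003, Thm. 14).

* `exists_dual_family_adapted` — from a family of linear forms without common zero, a sub-family
  that is a basis of the dual space and is adapted to a given index set.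
* `rank_lt_of_mulVec_eq_zero`, `rank_transpose_lt_of_ne` — the two rank-deficiency arguments of
  p. 50–51.
* `blaser2003_lemma7` — **Lemma 7** in invariant form: if `β` computes `⟨n,m,n⟩`
  (`m ≥ n ≥ 2`, `k` algebraically closed) with `r = 2mn + 2n − m − 3` products, then `β` or
  `βᵀ` admits disjoint index sets `G` (`|G| = mn`, `(g_ρ)_{ρ∈G}` a basis of `(k^{m×n})*`) and `F`
  (`|F| = mn + n − m − 1`) and a matrix `0 ≠ a ∈ ⋂_{ρ∈F} ker f_ρ` with `rk a ≤ n − 1`.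

## The printed proof (pp. 50–51) and this formalisation

We follow the proof step by step but never renumber products or change coordinates: an
`f`-basis `B_f`; `2n − 2` further indices `E` and Lemma 6 (`exists_isotropic_pair`) giving
`x₀, y₀ ≠ 0` with `x₀ᵀ w_ρ y₀ = 0` (`ρ ∈ E`) (printed: `w_ρ ∈ Z_1`); `R = {u | x₀ᵀ u = 0}` (printed:
`R^{n,m}`) and `A ⊆ B_f` restricting to a basis of `R*`; then every `c` killed by the `g_ρ`,
`ρ ∉ A ∪ E`, satisfies `x₀ᵀ (b c) y₀ = 0` for all `b`, so `b ↦ bc` misses `E_{i₀j₀}` (printed: "`c`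
cannot have full rank"); a `g`-basis `G` adapted to the complement of `A ∪ E` (which has `mn − 1`
elements), its dual basis `(y_μ)`, and `y_M` rank-deficient; a non-zero column `ν₀` of `y_M` and
`m − n + 1` indices `P ∋ M` whose `ν₀`-columns are independent (printed: "the first columns of
`y_{M+n−m}, …, y_M` are linearly independent"); finally the dichotomy: either the `f_ρ`,
`ρ ∈ P ∪ (ι ∖ G)`, have a common zero `a ≠ 0` — then `a y_μ = 0` (`μ ∈ P`) forces `rk a < n` — or
they contain an `f`-basis `J'`, and the transposed computation with `G' = J'`, `F' = G ∖ P`,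
`a = y_Mᵀ` does it.

## References

* M. Bläser, *On the complexity of the multiplication of matrices of small formats*,
  J. Complexity 19 (2003) 43–60, Lemma 7 and its proof (pp. 50–51). [Blaser2003]
-/

namespace Literature.Computability.AlgebraicComplexity

open Module Matrix

variable {k : Type*} [Field k]

/-! ## Linear-algebra helpers: bases extracted from families of linear forms -/

section Helpers

variable {V : Type*} [AddCommGroup V] [Module k V] [FiniteDimensional k V] {ι : Type*}

omit [FiniteDimensional k V] in
/-- A linear form in the span of forms vanishing at `v` vanishes at `v`. [folklore] -/
theorem dual_apply_eq_zero_of_mem_span {S : Set (Module.Dual k V)} {ψ : Module.Dual k V}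
    (h : ψ ∈ Submodule.span k S) (v : V) (h0 : ∀ φ ∈ S, φ v = 0) : ψ v = 0 := by
  have hle : Submodule.span k S ≤ LinearMap.ker (Module.Dual.eval k V v) :=
    Submodule.span_le.2 fun φ hφ => by simpa using h0 φ hφ
  simpa using hle h

omit [FiniteDimensional k V] in
/-- If `v ↦ (g_j v)_{j ∈ J}` is a bijection `V₁ → k^J`, then `|J| = dim V₁`. [folklore] -/
theorem card_eq_finrank_of_forall_exists_eq (V₁ : Submodule k V) (J : Finset ι)
    (g : ι → Module.Dual k V) (hinj : ∀ v ∈ V₁, (∀ j ∈ J, g j v = 0) → v = 0)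
    (hsurj : ∀ c : ι → k, ∃ v ∈ V₁, ∀ j ∈ J, g j v = c j) : J.card = finrank k V₁ := by
  classical
  let T : V₁ →ₗ[k] (J → k) := LinearMap.pi fun j => (g j).comp V₁.subtype
  have hTinj : Function.Injective T := by
    rw [← LinearMap.ker_eq_bot, LinearMap.ker_eq_bot']
    intro v hv
    exact Subtype.ext (hinj v v.2 fun j hj => by simpa [T] using congrFun hv ⟨j, hj⟩)
  have hTsurj : Function.Surjective T := by
    intro c'
    obtain ⟨v, hv, h⟩ := hsurj fun i => if h : i ∈ J then c' ⟨i, h⟩ else 0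
    exact ⟨⟨v, hv⟩, funext fun j => by simpa [T, j.2] using h j j.2⟩
  have e := LinearEquiv.ofBijective T ⟨hTinj, hTsurj⟩
  have := e.finrank_eq
  rw [Module.finrank_fintype_fun_eq_card, Fintype.card_coe] at this
  exact this.symm

/-- From a finite family of linear forms `g_i` on `V` without common zero and a set `C` of indices,
a sub-family `G` which is a basis of `V*` (no common zero, `v ↦ (g_i v)_{i∈G}` onto, `|G| = dim V`)
and whose members in `C` span the same space as all the `g_i`, `i ∈ C` ("let `i_1, …, i_d` be
indices such that `g_{i_1}, …, g_{i_d}` form a basis of this space; choose `i_{d+1}, …, i_M` such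
that `g_{i_1}, …, g_{i_M}` form a basis", Bläser 2003, p. 50). [cite: Blaser2003, §4 p. 50] -/
theorem exists_dual_family_adapted [Fintype ι] [DecidableEq ι] (g : ι → Module.Dual k V)
    (hall : ∀ v, (∀ i, g i v = 0) → v = 0) (C : Finset ι) :
    ∃ G : Finset ι, G.card = finrank k V ∧ (∀ v, (∀ i ∈ G, g i v = 0) → v = 0) ∧
      (∀ c : ι → k, ∃ v, ∀ i ∈ G, g i v = c i) ∧
      (∀ v, (∀ i ∈ G ∩ C, g i v = 0) → ∀ i ∈ C, g i v = 0) := by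
  classical
  obtain ⟨b₁, hb₁C, -, hspan₁, hli₁⟩ :=
    exists_linearIndepOn_extension (linearIndepOn_empty k g) (Set.empty_subset (C : Set ι))
  obtain ⟨b, -, hb₁b, hspan, hli⟩ := exists_linearIndepOn_extension hli₁ (Set.subset_univ b₁)
  have hbfin : b.Finite := Set.toFinite b
  set G := hbfin.toFinset with hG
  have hmemG : ∀ i, i ∈ G ↔ i ∈ b := fun i => hbfin.mem_toFinset
  have hGinj : ∀ v, (∀ i ∈ G, g i v = 0) → v = 0 := by
    intro v hv
    refine hall v fun i => ?_
    exact dual_apply_eq_zero_of_mem_span (hspan ⟨i, Set.mem_univ _, rfl⟩) v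
      (by rintro _ ⟨j, hj, rfl⟩; exact hv j ((hmemG j).2 hj))
  have hcard : G.card = finrank k V := by
    apply le_antisymm
    · have hli' : LinearIndependent k (fun i : G => g i) := by
        have e : (G : Set ι) = b := by simp [hG]
        have h1 : LinearIndepOn k g (G : Set ι) := by rw [e]; exact hli
        exact h1
      have := hli'.fintype_card_le_finrank
      rw [Subspace.dual_finrank_eq] at this
      simpa using this
    · have h := BilinComp.finrank_le_card_of_forall_eq_zero ⊤ G g (fun v _ hv => hGinj v hv)
      rwa [finrank_top] at h
  refine ⟨G, hcard, hGinj, ?_, ?_⟩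
  · -- surjectivity by dimension count
    intro c
    let T : V →ₗ[k] (G → k) := LinearMap.pi fun j => g j
    have hTinj : Function.Injective T := by
      rw [← LinearMap.ker_eq_bot, LinearMap.ker_eq_bot']
      intro v hv
      exact hGinj v fun j hj => by simpa [T] using congrFun hv ⟨j, hj⟩
    have hdim : finrank k V = finrank k (G → k) := by
      rw [Module.finrank_fintype_fun_eq_card, Fintype.card_coe, hcard]
    obtain ⟨v, hv⟩ := (LinearMap.injective_iff_surjective_of_finrank_eq_finrank hdim).1 hTinj
      fun j => c j
    exact ⟨v, fun j hj => by simpa [T] using congrFun hv ⟨j, hj⟩⟩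
  · intro v hv i hi
    refine dual_apply_eq_zero_of_mem_span (hspan₁ ⟨i, hi, rfl⟩) v ?_
    rintro _ ⟨j, hj, rfl⟩
    exact hv j (Finset.mem_inter.2 ⟨(hmemG j).2 (hb₁b hj), hb₁C hj⟩)

end Helpers

/-! ## Rank helpers -/

section RankHelpers

/-- If `a ∈ k^{n×m}` kills `m − n + 1` linearly independent vectors then `rk a < n`
("each of its `n` rows is orthogonal to … `m − n + 1` many [independent vectors]. Thus
`0 < rk a < n`", Bläser 2003, p. 51). [cite: Blaser2003, §4 p. 51] -/
theorem rank_lt_of_mulVec_eq_zero {n m : ℕ} (a : Matrix (Fin n) (Fin m) k) {ι : Type*}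
    (col : ι → (Fin m → k)) (P : Finset ι) (hli : LinearIndepOn k col (P : Set ι))
    (hP : P.card = m - n + 1) (h0 : ∀ μ ∈ P, a *ᵥ col μ = 0) : a.rank < n := by
  classical
  have hker : Submodule.span k (Set.range fun μ : P => col μ) ≤ LinearMap.ker a.mulVecLin := by
    rw [Submodule.span_le]
    rintro _ ⟨μ, rfl⟩
    simpa using h0 μ μ.2
  have hdim : finrank k (Submodule.span k (Set.range fun μ : P => col μ)) = m - n + 1 := by
    rw [finrank_span_eq_card (b := fun μ : P => col μ) hli, Fintype.card_coe, hP]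
  have h1 := Submodule.finrank_mono hker
  have h2 := LinearMap.finrank_range_add_finrank_ker a.mulVecLin
  rw [Module.finrank_fintype_fun_eq_card, Fintype.card_fin] at h2
  have h3 : a.rank = finrank k (LinearMap.range a.mulVecLin) := rfl
  omega

/-- If `b ↦ b y` (`k^{n×m} → k^{n×n}`) misses some matrix, then `rk yᵀ < n` (`y ∈ k^{m×n}`):
a matrix of rank `n` has a left inverse. [cite: Blaser2003, §4 p. 50] -/
theorem rank_transpose_lt_of_ne {n m : ℕ} (y : Matrix (Fin m) (Fin n) k)
    (h : ∃ z : Matrix (Fin n) (Fin n) k, ∀ b : Matrix (Fin n) (Fin m) k, b * y ≠ z) :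
    yᵀ.rank < n := by
  classical
  obtain ⟨z, hz⟩ := h
  have hle : yᵀ.rank ≤ n := by simpa using Matrix.rank_le_card_height yᵀ
  refine lt_of_le_of_ne hle fun heq => ?_
  have htop : LinearMap.range yᵀ.mulVecLin = ⊤ := by
    apply Submodule.eq_top_of_finrank_eq
    rw [Module.finrank_fintype_fun_eq_card, Fintype.card_fin]
    exact heq
  have hsurj : Function.Surjective yᵀ.mulVec := by
    intro t
    have : t ∈ LinearMap.range yᵀ.mulVecLin := htop ▸ Submodule.mem_top
    obtain ⟨s, hs⟩ := this
    exact ⟨s, hs⟩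
  obtain ⟨B, hB⟩ := Matrix.mulVec_surjective_iff_exists_right_inverse.1 hsurj
  have hB' : Bᵀ * y = 1 := by
    have := congrArg Matrix.transpose hB
    rwa [Matrix.transpose_mul, Matrix.transpose_transpose, Matrix.transpose_one] at this
  exact hz (z * Bᵀ) (by rw [Matrix.mul_assoc, hB', Matrix.mul_one])

end RankHelpers

/-! ## Lemma 7 -/

section Lemma7

/-- `x₀ᵀ (E_{i₀ j₀}) y₀ = x₀_{i₀} y₀_{j₀}`. [folklore] -/
theorem dotProduct_single_mulVec {n : ℕ} (x₀ y₀ : Fin n → k) (i₀ j₀ : Fin n) :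
    x₀ ⬝ᵥ (Matrix.single i₀ j₀ (1 : k) *ᵥ y₀) = x₀ i₀ * y₀ j₀ := by
  classical
  rw [Matrix.single_mulVec, one_mul]
  simp [dotProduct, Function.update_apply, Finset.sum_ite_eq']

/-- **Bläser 2003, Lemma 7** (in invariant form). Let `m ≥ n ≥ 2`, `k` algebraically closed,
and let `β` be a bilinear computation of `⟨n,m,n⟩` of length `r = 2mn + 2n − m − 3`. Then there is
a computation `β'` of `⟨n,m,n⟩` of the same length (namely `β` or `βᵀ`), disjoint index sets `G`
(`|G| = mn`) and `F` (`|F| = mn + n − m − 1`) and a matrix `a ∈ k^{n×m}` such that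
`(g_ρ)_{ρ ∈ G}` is a basis of `(k^{m×n})*`, `a ∈ ⋂_{ρ ∈ F} ker f_ρ`, and `1 ≤ rk a ≤ n − 1`.
(Printed: `g_1, …, g_M` a basis and `a ∈ ⋂_{μ=M+1}^{2M+n−m−1} ker f_μ`; the proof — choice of an
`f`-basis, Lemma 6, the rank-deficiency of every `c` killed by the complementary `g`'s, the dual
basis, and the dichotomy on `dim⟨f_{M+n−m}, …, f_r⟩` resolved by transposition — is followed
step by step, without the coordinate normalisations.) [cite: Blaser2003, Lemma 7] -/
theorem blaser2003_lemma7 [IsAlgClosed k] {m n : ℕ} (hn : 2 ≤ n) (hnm : n ≤ m) {ι : Type*}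
    [Fintype ι] [DecidableEq ι] (hcard : Fintype.card ι = 2 * (m * n) + 2 * n - m - 3)
    (β : BilinComp (mulBilin k n m n) ι) :
    ∃ (β' : BilinComp (mulBilin k n m n) ι) (G F : Finset ι) (a : Matrix (Fin n) (Fin m) k),
      G.card = m * n ∧ Disjoint G F ∧ F.card = m * n + n - m - 1 ∧
      (∀ y, (∀ ρ ∈ G, β'.g ρ y = 0) → y = 0) ∧
      (∀ c : ι → k, ∃ y, ∀ ρ ∈ G, β'.g ρ y = c ρ) ∧
      a ≠ 0 ∧ a.rank < n ∧ ∀ ρ ∈ F, β'.f ρ a = 0 := by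
  classical
  have hn0 : 0 < n := by omega
  have hm0 : 0 < m := by omega
  have hMm : m ≤ m * n := by nlinarith
  have hM2m : 2 * m ≤ m * n := by nlinarith
  -- Step A: an `f`-basis `Bf`
  obtain ⟨Bf, -, hBf_inj, hBf_surj⟩ := BilinComp.exists_subset_forall_exists_eq
    (⊤ : Submodule k (Matrix (Fin n) (Fin m) k)) Finset.univ β.f
    (fun x _ hx => β.eq_zero_of_forall_f hn0 x fun i => hx i (Finset.mem_univ i))
  have hBf_card : Bf.card = m * n := by
    rw [card_eq_finrank_of_forall_exists_eq ⊤ Bf β.f hBf_inj hBf_surj, finrank_top,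
      Module.finrank_matrix]
    simp [Nat.mul_comm]
  -- Step B: `2n - 2` of the other indices and Lemma 6
  have hcompl : 2 * n - 2 ≤ (Finset.univ \ Bf).card := by
    rw [Finset.card_sdiff_of_subset (Finset.subset_univ _), Finset.card_univ, hcard, hBf_card]
    omega
  obtain ⟨E, hEsub, hEcard⟩ := Finset.exists_subset_card_eq hcompl
  obtain ⟨x₀, y₀, hx₀, hy₀, hiso⟩ := exists_isotropic_pair k (n := n) (by omega)
    (fun ρ : E => β.w ρ) (by simp [hEcard])
  -- Step C: `R = {u | x₀ u = 0}` and `A ⊆ Bf` restricting to a basis of `R*`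
  let vm : Matrix (Fin n) (Fin m) k →ₗ[k] (Fin m → k) :=
    { toFun := fun u => x₀ ᵥ* u
      map_add' := fun u u' => Matrix.vecMul_add _ _ _
      map_smul' := fun c u => Matrix.vecMul_smul _ _ _ }
  let R : Submodule k (Matrix (Fin n) (Fin m) k) := LinearMap.ker vm
  obtain ⟨i₀, hi₀⟩ : ∃ i, x₀ i ≠ 0 := Function.ne_iff.1 hx₀
  obtain ⟨j₀, hj₀⟩ : ∃ j, y₀ j ≠ 0 := Function.ne_iff.1 hy₀
  have hR : finrank k R = m * n - m := by
    have hsurj : LinearMap.range vm = ⊤ := by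
      rw [LinearMap.range_eq_top]
      intro t
      refine ⟨Matrix.of fun i μ => if i = i₀ then t μ / x₀ i₀ else 0, funext fun μ => ?_⟩
      simp only [vm, LinearMap.coe_mk, AddHom.coe_mk, Matrix.vecMul, dotProduct, Matrix.of_apply,
        mul_ite, mul_zero, Finset.sum_ite_eq', Finset.mem_univ, if_true]
      field_simp
    have h := LinearMap.finrank_range_add_finrank_ker vm
    rw [hsurj, finrank_top, Module.finrank_fintype_fun_eq_card, Fintype.card_fin,
      Module.finrank_matrix] at h
    simp only [Fintype.card_fin, Module.finrank_self, mul_one] at h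
    change m + finrank k R = n * m at h
    rw [Nat.mul_comm] at h
    omega
  obtain ⟨A, hAsub, hA_inj, hA_surj⟩ :=
    BilinComp.exists_subset_forall_exists_eq R Bf β.f fun x _ hx => hBf_inj x trivial hx
  have hA_card : A.card = m * n - m :=
    (card_eq_finrank_of_forall_exists_eq R A β.f hA_inj hA_surj).trans hR
  -- Step D: every `c` killed by the `g_ρ`, `ρ ∉ A ∪ E`, is rank deficient
  have hAE : Disjoint A E := Finset.disjoint_left.2 fun ρ hρA hρE =>
    (Finset.mem_sdiff.1 (hEsub hρE)).2 (hAsub hρA)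
  set Gc := Finset.univ \ (A ∪ E) with hGc
  have hGc_card : Gc.card = m * n - 1 := by
    rw [hGc, Finset.card_sdiff_of_subset (Finset.subset_univ _), Finset.card_univ, hcard,
      Finset.card_union_of_disjoint hAE, hA_card, hEcard]
    omega
  have stepD : ∀ c : Matrix (Fin m) (Fin n) k, (∀ ρ ∈ Gc, β.g ρ c = 0) →
      ∀ b : Matrix (Fin n) (Fin m) k, x₀ ⬝ᵥ ((b * c) *ᵥ y₀) = 0 := by
    intro c hc b
    obtain ⟨u, hu, hfu⟩ := hA_surj fun ρ => β.f ρ b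
    have hu0 : x₀ ᵥ* u = 0 := by simpa [R, vm] using hu
    have hsplit : b * c = (b - u) * c + u * c := by rw [Matrix.sub_mul, sub_add_cancel]
    have h1 : x₀ ⬝ᵥ ((u * c) *ᵥ y₀) = 0 := by
      rw [Matrix.dotProduct_mulVec, ← Matrix.vecMul_vecMul, hu0, Matrix.zero_vecMul,
        zero_dotProduct]
    have h2 : x₀ ⬝ᵥ (((b - u) * c) *ᵥ y₀) = 0 := by
      have hexp := β.map_eq_sum (b - u) c
      rw [mulBilin_apply] at hexp
      rw [hexp, Matrix.sum_mulVec, dotProduct_sum]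
      refine Finset.sum_eq_zero fun ρ _ => ?_
      rw [Matrix.smul_mulVec, dotProduct_smul, smul_eq_mul]
      by_cases hρA : ρ ∈ A
      · have : β.f ρ (b - u) = 0 := by rw [map_sub, hfu ρ hρA, sub_self]
        simp [this]
      · by_cases hρE : ρ ∈ E
        · have := hiso ⟨ρ, hρE⟩
          simp only at this
          rw [this, mul_zero]
        · have hρGc : ρ ∈ Gc := by
            rw [hGc, Finset.mem_sdiff, Finset.mem_union]
            exact ⟨Finset.mem_univ _, fun h => h.elim hρA hρE⟩
          simp [hc ρ hρGc]
    rw [hsplit, Matrix.add_mulVec, dotProduct_add, h1, h2, add_zero]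
  have stepD' : ∀ c : Matrix (Fin m) (Fin n) k, (∀ ρ ∈ Gc, β.g ρ c = 0) →
      ∀ b : Matrix (Fin n) (Fin m) k, b * c ≠ Matrix.single i₀ j₀ (1 : k) := by
    intro c hc b hb
    have := stepD c hc b
    rw [hb, dotProduct_single_mulVec] at this
    exact mul_ne_zero hi₀ hj₀ this
  -- Step E: a `g`-basis `G` adapted to `Gc`, its dual basis, and `y_M`
  obtain ⟨G, hGcard, hG_inj, hG_surj, hG_C⟩ := exists_dual_family_adapted β.g
    (fun y hy => β.eq_zero_of_forall_g hn0 y hy) Gc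
  have hGcard' : G.card = m * n := by
    rw [hGcard, Module.finrank_matrix]; simp
  have hdual : ∀ μ, ∃ y : Matrix (Fin m) (Fin n) k, ∀ ρ ∈ G, β.g ρ y = if ρ = μ then 1 else 0 :=
    fun μ => hG_surj fun ρ => if ρ = μ then 1 else 0
  choose y hy using hdual
  obtain ⟨iM, hiMG, hiMGc⟩ : ∃ i ∈ G, i ∉ Gc := by
    by_contra h
    push Not at h
    have : G.card ≤ Gc.card := Finset.card_le_card h
    omega
  have hyM_Gc : ∀ ρ ∈ Gc, β.g ρ (y iM) = 0 := hG_C (y iM) fun ρ hρ => by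
    rw [hy iM ρ (Finset.mem_inter.1 hρ).1, if_neg]
    rintro rfl
    exact hiMGc (Finset.mem_inter.1 hρ).2
  have hyM_def := stepD' (y iM) hyM_Gc
  have hyM1 : β.g iM (y iM) = 1 := by rw [hy iM iM hiMG, if_pos rfl]
  have hyM_ne : y iM ≠ 0 := by
    intro h0
    rw [h0, map_zero] at hyM1
    exact zero_ne_one hyM1
  -- every matrix is the combination `∑_{μ∈G} g_μ(Y) y_μ`
  have hexpand : ∀ Y : Matrix (Fin m) (Fin n) k, Y = ∑ μ ∈ G, β.g μ Y • y μ := by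
    intro Y
    have h0 := hG_inj (Y - ∑ μ ∈ G, β.g μ Y • y μ) fun ρ hρ => by
      rw [map_sub, map_sum]
      simp_rw [map_smul, smul_eq_mul]
      rw [Finset.sum_eq_single ρ (fun μ hμ hμρ => by rw [hy μ ρ hρ, if_neg (Ne.symm hμρ), mul_zero])
        (fun h => absurd hρ h), hy ρ ρ hρ, if_pos rfl, mul_one, sub_self]
    exact (sub_eq_zero.1 h0)
  -- Step F: a column `ν₀` of `y_M` is non-zero; `m - n + 1` indices with independent columns
  obtain ⟨μ₀, ν₀, hμν⟩ : ∃ μ₀ ν₀, y iM μ₀ ν₀ ≠ 0 := by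
    by_contra hall
    push Not at hall
    exact hyM_ne (Matrix.ext fun μ ν => hall μ ν)
  let col : ι → (Fin m → k) := fun μ μ' => y μ μ' ν₀
  have hcol_span : ∀ t : Fin m → k, t ∈ Submodule.span k (col '' (G : Set ι)) := by
    intro t
    let Y : Matrix (Fin m) (Fin n) k := Matrix.of fun μ' ν => if ν = ν₀ then t μ' else 0
    have ht : t = fun μ' => Y μ' ν₀ := funext fun μ' => by simp [Y]
    have hY := hexpand Y
    have ht' : t = ∑ μ ∈ G, β.g μ Y • col μ := by
      rw [ht]
      conv_lhs => rw [hY]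
      funext μ'
      simp [col, Matrix.sum_apply, Finset.sum_apply]
    rw [ht']
    exact Submodule.sum_mem _ fun μ hμ =>
      Submodule.smul_mem _ _ (Submodule.subset_span ⟨μ, hμ, rfl⟩)
  have hcoliM : col iM ≠ 0 := fun h => hμν (by simpa [col] using congrFun h μ₀)
  obtain ⟨P', hP'G, hiMP', hspanP', hliP'⟩ := exists_linearIndepOn_extension
    (LinearIndepOn.singleton (R := k) (v := col) (i := iM) hcoliM)
    (Set.singleton_subset_iff.2 (Finset.mem_coe.2 hiMG))
  have hP'fin : P'.Finite := G.finite_toSet.subset hP'G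
  haveI : Fintype P' := hP'fin.fintype
  have hP'card : hP'fin.toFinset.card = m := by
    have h1 : finrank k (Submodule.span k (Set.range fun μ : P' => col μ)) = Fintype.card P' :=
      finrank_span_eq_card hliP'
    have h2 : Submodule.span k (Set.range fun μ : P' => col μ) = ⊤ := by
      rw [eq_top_iff]
      intro t _
      have : Set.range (fun μ : P' => col μ) = col '' P' := by
        ext x; simp
      rw [this]
      exact (Submodule.span_le.2 hspanP') (hcol_span t)
    rw [h2, finrank_top, Module.finrank_fintype_fun_eq_card, Fintype.card_fin] at h1
    rw [Set.Finite.card_toFinset]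
    exact h1.symm
  have hiMPf : iM ∈ hP'fin.toFinset := hP'fin.mem_toFinset.2 (hiMP' rfl)
  obtain ⟨P₀, hP₀sub, hP₀card⟩ := Finset.exists_subset_card_eq
    (s := hP'fin.toFinset.erase iM) (n := m - n)
    (by rw [Finset.card_erase_of_mem hiMPf, hP'card]; omega)
  set P := insert iM P₀ with hP
  have hiMP₀ : iM ∉ P₀ := fun h => by simpa using hP₀sub h
  have hPcard : P.card = m - n + 1 := by rw [hP, Finset.card_insert_of_notMem hiMP₀, hP₀card]
  have hPP' : (P : Set ι) ⊆ P' := by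
    intro μ hμ
    rcases Finset.mem_insert.1 (Finset.mem_coe.1 hμ) with rfl | hμ
    · exact hiMP' rfl
    · exact hP'fin.mem_toFinset.1 (Finset.mem_of_mem_erase (hP₀sub hμ))
  have hPG : P ⊆ G := fun μ hμ => Finset.mem_coe.1 (hP'G (hPP' (Finset.mem_coe.2 hμ)))
  have hliP : LinearIndepOn k col (P : Set ι) := hliP'.mono hPP'
  have hiMP : iM ∈ P := Finset.mem_insert_self _ _
  -- Step G: the dichotomy on the forms `f_ρ`, `ρ ∈ F₂ = P ∪ (ι ∖ G)`
  set F₂ := P ∪ (Finset.univ \ G) with hF₂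
  by_cases hcase : ∀ x : Matrix (Fin n) (Fin m) k, (∀ ρ ∈ F₂, β.f ρ x = 0) → x = 0
  · -- Case 2: an `f`-basis inside `F₂`; transpose
    obtain ⟨J', hJ'sub, hJ'_inj, hJ'_surj⟩ := BilinComp.exists_subset_forall_exists_eq
      (⊤ : Submodule k (Matrix (Fin n) (Fin m) k)) F₂ β.f fun x _ hx => hcase x hx
    have hJ'card : J'.card = m * n := by
      rw [card_eq_finrank_of_forall_exists_eq ⊤ J' β.f hJ'_inj hJ'_surj, finrank_top,
        Module.finrank_matrix]
      simp [Nat.mul_comm]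
    refine ⟨β.transposed, J', G \ P, (y iM)ᵀ, hJ'card, ?_, ?_, ?_, ?_, ?_, ?_, ?_⟩
    · refine Finset.disjoint_left.2 fun ρ hρJ hρ => ?_
      obtain ⟨hρG, hρP⟩ := Finset.mem_sdiff.1 hρ
      rcases Finset.mem_union.1 (hJ'sub hρJ) with h | h
      · exact hρP h
      · exact (Finset.mem_sdiff.1 h).2 hρG
    · rw [Finset.card_sdiff_of_subset hPG, hGcard', hPcard]
      omega
    · intro z hz
      have : zᵀ = 0 := hJ'_inj zᵀ trivial fun ρ hρ => by simpa using hz ρ hρ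
      exact Matrix.transpose_eq_zero.1 this
    · intro c
      obtain ⟨x, -, hx⟩ := hJ'_surj c
      exact ⟨xᵀ, fun ρ hρ => by simpa using hx ρ hρ⟩
    · exact fun h => hyM_ne (Matrix.transpose_eq_zero.1 h)
    · exact rank_transpose_lt_of_ne (y iM) ⟨_, hyM_def⟩
    · intro ρ hρ
      obtain ⟨hρG, hρP⟩ := Finset.mem_sdiff.1 hρ
      rw [BilinComp.transposed_f, Matrix.transpose_transpose, hy iM ρ hρG, if_neg]
      rintro rfl
      exact hρP hiMP
  · -- Case 1: a non-zero `a` in the common kernel of the `f_ρ`, `ρ ∈ F₂`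
    push Not at hcase
    obtain ⟨a, haF₂, ha0⟩ := hcase
    have hcomplG : m * n + n - m - 1 ≤ (Finset.univ \ G).card := by
      rw [Finset.card_sdiff_of_subset (Finset.subset_univ _), Finset.card_univ, hcard, hGcard']
      omega
    obtain ⟨F, hFsub, hFcard⟩ := Finset.exists_subset_card_eq hcomplG
    refine ⟨β, G, F, a, hGcard', ?_, hFcard, hG_inj, hG_surj, ha0, ?_, fun ρ hρ => haF₂ ρ ?_⟩
    · exact Finset.disjoint_left.2 fun ρ hρG hρF => (Finset.mem_sdiff.1 (hFsub hρF)).2 hρG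
    · -- `a y_μ = 0` for `μ ∈ P`, hence `a` kills the `m - n + 1` independent columns `col μ`
      have hay : ∀ μ ∈ P, a * y μ = 0 := by
        intro μ hμ
        have hexp := β.map_eq_sum a (y μ)
        rw [mulBilin_apply] at hexp
        rw [hexp]
        refine Finset.sum_eq_zero fun ρ _ => ?_
        by_cases hρ : ρ ∈ F₂
        · simp [haF₂ ρ hρ]
        · have hρG : ρ ∈ G := by
            by_contra h
            exact hρ (Finset.mem_union_right _ (Finset.mem_sdiff.2 ⟨Finset.mem_univ _, h⟩))
          have hρP : ρ ∉ P := fun h => hρ (Finset.mem_union_left _ h)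
          have hne : ρ ≠ μ := fun h => hρP (h ▸ hμ)
          rw [hy μ ρ hρG, if_neg hne]
          simp
      refine rank_lt_of_mulVec_eq_zero a col P hliP hPcard fun μ hμ => ?_
      funext i
      have := congrFun (congrFun (hay μ hμ) i) ν₀
      simpa [Matrix.mul_apply, Matrix.mulVec, dotProduct, col] using this
    · exact Finset.mem_union_right _ (hFsub hρ)

/-- **Lemma 7 with rows adapted to `a`** (Bläser 2003, Lemma 7 and p. 51: "By sandwiching, we
may assume that `a` has the form `[0 0; 0 I_{rk a}]`"): the data of Lemma 7 can moreover be chosen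
such that `a k^{m×n}` is exactly the space of matrices whose first `n − rk a` rows vanish.
[cite: Blaser2003, Lemma 7] -/
theorem blaser2003_lemma7_adapted [IsAlgClosed k] {m n : ℕ} (hn : 2 ≤ n) (hnm : n ≤ m) {ι : Type*}
    [Fintype ι] [DecidableEq ι] (hcard : Fintype.card ι = 2 * (m * n) + 2 * n - m - 3)
    (β : BilinComp (mulBilin k n m n) ι) :
    ∃ (β' : BilinComp (mulBilin k n m n) ι) (G F : Finset ι) (a : Matrix (Fin n) (Fin m) k),
      G.card = m * n ∧ Disjoint G F ∧ F.card = m * n + n - m - 1 ∧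
      (∀ y, (∀ ρ ∈ G, β'.g ρ y = 0) → y = 0) ∧
      (∀ c : ι → k, ∃ y, ∀ ρ ∈ G, β'.g ρ y = c ρ) ∧
      a ≠ 0 ∧ a.rank < n ∧ (∀ ρ ∈ F, β'.f ρ a = 0) ∧
      ∀ z : Matrix (Fin n) (Fin n) k,
        (∃ y : Matrix (Fin m) (Fin n) k, a * y = z) ↔ z ∈ topZero k n n (n - a.rank) := by
  obtain ⟨β', G, F, a, hG, hGF, hF, hGinj, hGsurj, ha0, hrank, hFa⟩ :=
    blaser2003_lemma7 hn hnm hcard β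
  obtain ⟨u, u', hu, hu', hadapt⟩ := exists_rows_adapted a
  have hrank' : (u * a).rank = a.rank := by
    apply le_antisymm (Matrix.rank_mul_le_right u a)
    have : a = u' * (u * a) := by rw [← Matrix.mul_assoc, hu', Matrix.one_mul]
    conv_lhs => rw [this]
    exact Matrix.rank_mul_le_right u' (u * a)
  refine ⟨β'.sandwich u u' 1 1 hu (Matrix.one_mul 1), G, F, u * a, hG, hGF, hF, ?_, ?_, ?_, ?_,
    ?_, ?_⟩
  · intro y hy
    exact hGinj y fun ρ hρ => by simpa using hy ρ hρ
  · intro c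
    obtain ⟨y, hy⟩ := hGsurj c
    exact ⟨y, fun ρ hρ => by simpa using hy ρ hρ⟩
  · intro h
    apply ha0
    have : u' * (u * a) = 0 := by rw [h, Matrix.mul_zero]
    rwa [← Matrix.mul_assoc, hu', Matrix.one_mul] at this
  · rwa [hrank']
  · intro ρ hρ
    rw [BilinComp.sandwich_f, ← Matrix.mul_assoc, hu', Matrix.one_mul]
    exact hFa ρ hρ
  · intro z
    rw [hrank', ← hadapt z]
    simp only [Matrix.mul_assoc]

end Lemma7

end Literature.Computability.AlgebraicComplexity
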